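import Literature.AlgebraicGeometry.Resolution.ProjectiveBirationalBlowup
import Literature.AlgebraicGeometry.Resolution.ProperModelsFunctionField
import Literature.AlgebraicGeometry.Resolution.RationalVectorIdealSheaf
import Literature.AlgebraicGeometry.Resolution.ProperModelsModification
import Literature.AlgebraicGeometry.Resolution.BlowupsExistence
import Literature.AlgebraicGeometry.Resolution.BlowupsIntegral
import Literature.AlgebraicGeometry.Resolution.BlowupsProperProofs
import Literature.AlgebraicGeometry.Resolution.EffectiveCartierStalks
import Literature.AlgebraicGeometry.Resolution.RationalMapsOfModels
import HarnessLib

/-!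
# A projective birational morphism of projective varieties is a blowing up (Liu 2002, Thm. 8.1.24) — proof

Topic: `Literature/AlgebraicGeometry/Resolution`. DISCHARGE of the named fact
`Liu2002Thm8124Projective` (`ProjectiveBirationalBlowup.lean`; Liu, *Algebraic Geometry and
Arithmetic Curves*, Thm. 8.1.24 = Hartshorne II.7.17, in the special case of a birational
`k`-morphism `f : X → Y` of integral PROJECTIVE `k`-schemes): there is a non-zero ideal sheaf `I`
on `Y` such that `f` is a blowing up of `Y` along `I` (`IsBlowup`, the universal property of
Görtz–Wedhorn I, Def. 13.90).

## The proof and how it relates to the printed one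

Liu's printed proof (pp. 327–329: Lemma 1.21, Prop. 1.22, Lemma 1.23, Thm. 1.24) identifies `X`
with `Proj ⨁ f_*𝓛^{⊗d}` for `𝓛 = 𝒪_X(1)` (Lemma 1.23, via Serre vanishing `R¹f_* 𝓘(n) = 0`,
Thm. 5.3.2), embeds `𝓕 = f_*𝓛 ⊆ 𝒦_Y`, twists by an invertible `𝒩 = 𝓜^∨ ⊆ 𝒦_Y` coming from an
ample `𝓜` so that `𝓘 = 𝒩𝓕 ⊆ 𝒪_Y` is an ideal, and concludes `X ≅ Proj ⨁ 𝓘ⁿ` by Lemma 1.21.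
Mathlib (pin v4.32) has no relative `Proj`, no higher direct images and no Serre vanishing, so
the architecture "compare two `Proj`s" cannot be followed literally. We keep Liu's TWIST
`𝓘 = 𝒩 · 𝓕` (`RationalVectorIdealSheaf.lean`: `𝓕 = ∑ 𝒪_Y z_l` for homogeneous coordinates
`(z₀ : … : zₙ)` of the inverse rational map `Y ⋯→ X ⊆ ℙⁿ_k`, `𝒩 = 𝒪_Y(-E)` for a pole-clearing
effective Cartier divisor `E` built from a hyperplane section of `Y ⊆ ℙᵐ_k` — this is where
projectivity of `Y` enters, as in print) and replace the comparison of `Proj`s by the UNIVERSAL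
PROPERTY of the blowing up `π : B → Y` of `𝓘`, which exists in the tree (`exists_isBlowup`,
Görtz–Wedhorn I, Prop. 13.92) — the shorter road the tree provides (Hartshorne II Example 7.17.3:
blowing up `𝓘` makes the rational map a morphism):

1. **`𝓘·𝒪_X` is invertible** (`isEffectiveCartier_comap`): at `x ∈ X` in the chart `D₊(x_i)`
   of `X ⊆ ℙⁿ`, the ratios `z_l/z_i` are regular, so `(𝓘𝒪_X)_x = (q z_l)_l = (q z_i)` is
   principal (`span_range_eq_span_singleton_of_mem_lsChart`); hence the universal property gives
   `g : X → B` over `Y`.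
2. **`(z₀ : … : zₙ) ∘ π` is defined everywhere on `B`** (`isDefinedAt_of_span_range_eq_span_singleton`):
   `(𝓘𝒪_B)_b = (q z_l)_l` is principal with a regular generator, and in a local ring a generating
   set of a principal ideal contains a generator `q z_i` (Nakayama,
   `exists_mem_span_singleton_eq_of_span_eq`), so all `z_l/z_i ∈ 𝒪_{B,b}`; hence
   (Hartshorne II Thm. 7.1) a `k`-morphism `h : B → X` compatible with the generic points
   (`ProperModel.exists_hom_of_forall_isDefinedAt`, the tree's `toProjOfVec`).
3. **`g` and `h` are inverse**: `h ≫ f = π` and `g ≫ h = 𝟙` because morphisms between proper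
   models of one function field are unique (`ProperModel.Hom.f_eq`: separatedness + agreement at
   the generic point), and `h ≫ g = 𝟙` by the uniqueness half of the universal property
   (`IsBlowup.eq_id_of_comp_eq`). So `f ≅ π` over `Y` and `f` is a blowing up of `𝓘`
   (`IsBlowup.iso_comp`).

The bookkeeping is done in the language of PROPER MODELS of the common function field `K = K(Y)`
(`ProperModel`, Zariski–Samuel II, Ch. VI §17; `ProperModels.lean`): `Y`, `X` (a modification of
`Y`, `ProperModel.ofModification`) and the blowing up `B` are proper models of `K/k`.

* `ProperModel.Hom.exists_isBlowup_of_isProjectiveOver` — the theorem for a morphism of proper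
  models `N → M` with `N`, `M` projective over `k`;
* `Liu2002Thm8124Projective_holds` — the named fact DISCHARGED.

## References

* Q. Liu, *Algebraic Geometry and Arithmetic Curves*, OUP 2002, §8.1.3, Thm. 8.1.24 (proof,
  pp. 328–329), Lemma 1.21, Prop. 1.22. [Liu2002]
* R. Hartshorne, *Algebraic Geometry* (1977), II Thm. 7.17 and Example 7.17.3. [Hartshorne1977]
* U. Görtz, T. Wedhorn, *Algebraic Geometry I*, 2nd ed. (2020), Def. 13.90, Prop. 13.92.
  [GortzWedhorn2020]
* O. Zariski, P. Samuel, *Commutative Algebra* II, Ch. VI §17 (models). [ZariskiSamuel1960]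
-/

noncomputable section

open CategoryTheory CategoryTheory.Limits AlgebraicGeometry TopologicalSpace IsLocalRing
open Literature.AlgebraicGeometry.Motives Literature.AlgebraicGeometry.Motives.RatFn

attribute [local instance] MvPolynomial.gradedAlgebra

namespace Literature.AlgebraicGeometry.Resolution

universe u

/-! ## Principal stalks of `q · (z₀, …, zₙ)` versus definedness of `(z₀ : … : zₙ)` -/

section Local

variable {X : Scheme.{u}} [IsIntegral X] {n : ℕ} {z : Fin (n + 1) → X.functionField} {x : X}

/-- **Where `(z₀ : … : zₙ)` is defined through the chart `D₊(x_i)`, the ideal `(q z₀, …, q zₙ)𝒪_{X,x}`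
is principal, generated by `q z_i`**: all `z_l/z_i` lie in `𝒪_{X,x}` (Hartshorne II Example
7.17.3: "`𝓘_x = 𝒪_x` if and only if `x ∈ U`", for the twisted ideal). [cite: Hartshorne1977, II Example 7.17.3] -/
theorem span_range_eq_span_singleton_of_mem_lsChart {i : Fin (n + 1)} (hx : x ∈ lsChart z i)
    {q : X.functionField} (g : Fin (n + 1) → X.presheaf.stalk x)
    (hg : ∀ l, toFunctionField x (g l) = q * z l) :
    Ideal.span (Set.range g) = Ideal.span {g i} := by
  have hzi : z i ≠ 0 := ne_zero_of_mem_lsChart z hx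
  apply le_antisymm
  · rw [Ideal.span_le]
    rintro _ ⟨l, rfl⟩
    obtain ⟨c, hc⟩ := isRegularAt_of_mem_lsChart z hx l
    have hgl : g l = c * g i := toFunctionField_injective x (by
      rw [map_mul, hc, hg, hg]
      field_simp)
    exact Ideal.mem_span_singleton'.mpr ⟨c, hgl.symm⟩
  · exact Ideal.span_mono (Set.singleton_subset_iff.mpr ⟨i, rfl⟩)

/-- **Conversely, if `(q z₀, …, q zₙ)𝒪_{X,x}` is principal with a non-zero generator then
`(z₀ : … : zₙ)` is defined at `x`**: in the local ring `𝒪_{X,x}` one of the `q z_i` already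
generates (Nakayama, `exists_mem_span_singleton_eq_of_span_eq`), and then `z_l/z_i ∈ 𝒪_{X,x}` for
all `l` (Hartshorne II Example 7.17.3: "`π⁻¹𝓘·𝒪_{X̃}` is an invertible sheaf … so we can define
a morphism `X̃ → ℙⁿ`"). [cite: Hartshorne1977, II Example 7.17.3] -/
theorem isDefinedAt_of_span_range_eq_span_singleton {q : X.functionField}
    (g : Fin (n + 1) → X.presheaf.stalk x) (hg : ∀ l, toFunctionField x (g l) = q * z l)
    {u : X.presheaf.stalk x} (hu : u ≠ 0) (h : Ideal.span (Set.range g) = Ideal.span {u}) :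
    IsDefinedAt z x := by
  obtain ⟨_, ⟨i, rfl⟩, hi⟩ := exists_mem_span_singleton_eq_of_span_eq hu h
  have hgi : g i ≠ 0 := by
    intro h0
    rw [h0, Ideal.span_singleton_eq_bot.mpr rfl, eq_comm, Ideal.span_singleton_eq_bot] at hi
    exact hu hi
  have hqzi : q * z i ≠ 0 := by
    rw [← hg i]
    exact (map_ne_zero_iff _ (toFunctionField_injective x)).mpr hgi
  have hzi : z i ≠ 0 := right_ne_zero_of_mul hqzi
  have hq : q ≠ 0 := left_ne_zero_of_mul hqzi
  refine ⟨i, (mem_lsChart_iff z).mpr ⟨hzi, fun l => ?_⟩⟩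
  have hl : g l ∈ Ideal.span {g i} := by
    rw [hi, ← h]
    exact Ideal.subset_span ⟨l, rfl⟩
  obtain ⟨c, hc⟩ := Ideal.mem_span_singleton'.mp hl
  refine ⟨c, ?_⟩
  have e : toFunctionField x c * (q * z i) = q * z l := by
    rw [← hg i, ← hg l, ← map_mul, hc]
  rw [eq_div_iff hzi]
  apply mul_left_cancel₀ hq
  rw [← e]
  ring

end Local

/-! ## Proper models: coordinates, and the rational map to a projective model as a morphism -/

namespace ProperModel

variable {k K : Type u} [Field k] [Field K] [Algebra k K]

/-- **Homogeneous coordinates of the generic point of a projective proper model**: a closed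
`k`-immersion `ι_B : B ↪ ℙⁿ_k` and `w ∈ Kⁿ⁺¹ ∖ 0` with `gen_B ≫ ι_B = (w₀ : … : wₙ)` (every
`K`-point of `ℙⁿ_k` has homogeneous coordinates, `ProjectiveSpace.exists_eq_pointOfVec`).
[folklore] -/
theorem exists_coords (B : ProperModel k K) (hB : IsProjectiveOver (Over.mk B.π)) :
    ∃ (n : ℕ) (ιB : B.X ⟶ Proj (Segre.grading (Fin (n + 1)) k)) (_ : IsClosedImmersion ιB)
      (_ : ιB ≫ Segre.toSpec (Fin (n + 1)) k = B.π) (w : Fin (n + 1) → K) (hw : w ≠ 0),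
      B.gen ≫ ιB = (ProjectiveSpace.pointOfVec k w hw).left := by
  obtain ⟨n, ιB', hιB'⟩ := hB
  let gB : specOver k K ⟶ Over.mk B.π := Over.homMk B.gen (by exact B.gen_π)
  let P₁ : AlgPoints (projectiveSpace n k) K := gB ≫ ιB'
  obtain ⟨w, hw, hPw⟩ := ProjectiveSpace.exists_eq_pointOfVec (k := k) (L := K) P₁
  exact ⟨n, ιB'.left, hιB', Over.w ιB', w, hw, by rw [← hPw]; rfl⟩

/-- **The rational map `B ⋯→ N ⊆ ℙⁿ_k` between proper models is a morphism of models as soon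
as it is defined everywhere** (Hartshorne II Thm. 7.1; Piltant 2013, Lemma 3.3; the proper-model,
whole-scheme form of `ProjModel.exists_hom_of_isDefinedAt`). Here `N ↪ ℙⁿ_k` is a closed
`k`-immersion, `w ∈ Kⁿ⁺¹` are homogeneous coordinates of the generic point of `N`, and the rational
map on `B` is `(w₀ : … : wₙ)` read in `K(B) ≅ K`; if it is defined at every point of `B` it is a
`k`-morphism `B → ℙⁿ_k` (`toProjOfVec`) with generic point `(w₀ : … : wₙ)`, which factors through
`N` (`B` is reduced and the image of its generic point lies in the closed `N`), compatibly with
the `K`-points. [cite: Hartshorne1977, II Thm. 7.1] -/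
theorem exists_hom_of_forall_isDefinedAt (B N : ProperModel k K) {n : ℕ}
    (ιN : N.X ⟶ Proj (Segre.grading (Fin (n + 1)) k)) [IsClosedImmersion ιN]
    (hιN : ιN ≫ Segre.toSpec (Fin (n + 1)) k = N.π) (w : Fin (n + 1) → K) (hw : w ≠ 0)
    (hgenN : N.gen ≫ ιN = (ProjectiveSpace.pointOfVec k w hw).left)
    (hdef : ∀ b : B.X, IsDefinedAt (fun l => B.funFieldAlgEquiv.symm (w l)) b) :
    ∃ h : B.X ⟶ N.X, h ≫ N.π = B.π ∧ B.gen ≫ h = N.gen := by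
  classical
  let e : K ≃ₐ[k] B.X.functionField := B.funFieldAlgEquiv.symm
  let zB : Fin (n + 1) → B.X.functionField := fun l => e (w l)
  have hzB : zB ≠ 0 := ProjectiveSpace.algHom_comp_ne_zero e.toAlgHom hw
  have hdefB : ∀ b : B.X, IsDefinedAt zB b := hdef
  /- the morphism `rB : B → ℙⁿ_k` and its generic point -/
  let rB := toProjOfVec zB B.π hdefB
  have hgenrB : B.X.fromSpecStalk (genericPoint B.X) ≫ rB =
      (ProjectiveSpace.pointOfVec k zB hzB).left :=
    fromSpecStalk_genericPoint_toProjOfVec zB B.π hdefB B.fromSpecStalk_genericPoint_π hzB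
  have he : CommRingCat.ofHom (e.toAlgHom : K →+* B.X.functionField) = B.funFieldIso.inv := by
    ext b; rfl
  have hpte : (ProjectiveSpace.pointOfVec k zB hzB).left =
      Spec.map B.funFieldIso.inv ≫ N.gen ≫ ιN := by
    rw [hgenN, ← he]
    exact (ProjectiveSpace.specMap_comp_pointOfVec_left e.toAlgHom w hw).symm
  /- `rB` factors through `N ↪ ℙⁿ_k` -/
  have hrange : Set.range rB ⊆ Set.range ιN := by
    have hξ : rB (genericPoint B.X) ∈ Set.range ιN := by
      have h1 := congrArg (fun φ => φ (closedPoint _)) hgenrB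
      simp only [Scheme.Hom.comp_apply, Scheme.fromSpecStalk_closedPoint] at h1
      rw [h1, hpte]
      exact ⟨_, rfl⟩
    rintro _ ⟨y, rfl⟩
    have hy : y ∈ closure ({genericPoint B.X} : Set B.X) := by
      rw [genericPoint_closure]; trivial
    have h2 : rB y ∈ closure (rB '' {genericPoint B.X}) :=
      map_mem_closure rB.continuous hy fun x hx => Set.mem_image_of_mem rB hx
    rw [Set.image_singleton] at h2
    exact (ιN.isClosedEmbedding.isClosed_range.closure_subset_iff.mpr
      (Set.singleton_subset_iff.mpr hξ)) h2
  let h : B.X ⟶ N.X := IsClosedImmersion.liftOfRange ιN rB hrange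
  have hhι : h ≫ ιN = rB := IsClosedImmersion.liftOfRange_fac _ _ _
  refine ⟨h, ?_, ?_⟩
  · rw [← hιN, ← Category.assoc, hhι]
    exact toProjOfVec_toSpec zB B.π hdefB
  · rw [← cancel_mono ιN, Category.assoc, hhι, ← B.specMap_funFieldIso_hom_fromSpecStalk,
      Category.assoc, hgenrB, hpte, ← Spec.map_comp_assoc, Iso.inv_hom_id, Spec.map_id,
      Category.id_comp]

/-! ## The theorem for proper models -/

/-- The generic point of a reduced irreducible scheme lies outside the support of every non-zero
ideal sheaf. [folklore] -/
theorem _root_.Literature.AlgebraicGeometry.Resolution.genericPoint_mem_centreCompl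
    {Y : Scheme.{u}} [IsIntegral Y] {I : Y.IdealSheafData} (hI : I ≠ ⊥) :
    genericPoint Y ∈ centreCompl I := by
  intro hη
  apply hI
  rw [← Scheme.IdealSheafData.support_eq_top_iff]
  apply TopologicalSpace.Closeds.ext
  apply Set.eq_univ_of_univ_subset
  have hcl := (genericPoint_spec Y).def
  rw [← hcl]
  exact I.support.isClosed.closure_subset_iff.mpr (Set.singleton_subset_iff.mpr hη)

/-- **A morphism of projective models is a blowing up** (Liu 2002, Thm. 8.1.24 / Hartshorne
II.7.17 for models of a function field): for proper models `N`, `M` of `K/k` which are projective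
over `k` and a morphism of models `φ : N → M`, there is a non-zero ideal sheaf `I` on `M` with
`IsBlowup φ.f I`. See the module docstring for the proof (twist `𝓘 = 𝒪_M(-E)·(z₀,…,zₙ)` of the
homogeneous coordinates of the inverse rational map; `𝓘𝒪_N` invertible gives `N → Bl_𝓘 M`;
principality of `𝓘𝒪_{Bl}` makes `Bl_𝓘 M ⋯→ N` a morphism; the two are inverse by uniqueness of
morphisms of models and of the universal property). [cite: Liu2002, Thm. 8.1.24] -/
theorem Hom.exists_isBlowup_of_isProjectiveOver {N M : ProperModel k K} (φ : N.Hom M)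
    (hN : IsProjectiveOver (Over.mk N.π)) (hM : IsProjectiveOver (Over.mk M.π)) :
    ∃ I : M.X.IdealSheafData, I ≠ ⊥ ∧ IsBlowup φ.f I := by
  classical
  /- coordinates: `N ↪ ℙⁿ_k` with generic point `(w₀ : … : wₙ)`, and `M ↪ ℙᵐ_k` -/
  obtain ⟨n, ιN, hιNci, hιN, w, hw, hgenN⟩ := N.exists_coords hN
  haveI := hιNci
  obtain ⟨m, ιM, hιM⟩ := hM
  let rM : M.X ⟶ Proj (Segre.grading (Fin (m + 1)) k) := ιM.left
  haveI : IsClosedImmersion rM := hιM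
  /- the rational functions `z` on `M`, `zN` on `N` -/
  let eM : K ≃ₐ[k] M.X.functionField := M.funFieldAlgEquiv.symm
  let eN : K ≃ₐ[k] N.X.functionField := N.funFieldAlgEquiv.symm
  let z : Fin (n + 1) → M.X.functionField := fun l => eM (w l)
  let zN : Fin (n + 1) → N.X.functionField := fun l => eN (w l)
  have hz0 : z ≠ 0 := ProjectiveSpace.algHom_comp_ne_zero eM.toAlgHom hw
  have hzN0 : zN ≠ 0 := ProjectiveSpace.algHom_comp_ne_zero eN.toAlgHom hw
  have hφz : ∀ l, functionFieldMap φ.f (z l) = zN l := fun l =>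
    functionFieldMap_funFieldAlgEquiv_symm φ (w l)
  /- `zN` is defined everywhere on `N`: the closed immersion `ιN` has generic point `(zN)` -/
  have hrN : N.X.fromSpecStalk (genericPoint N.X) ≫ ιN =
      (ProjectiveSpace.pointOfVec k zN hzN0).left := by
    rw [N.fromSpecStalk_genericPoint_eq, Category.assoc, hgenN]
    have heN : CommRingCat.ofHom (eN.toAlgHom : K →+* N.X.functionField) = N.funFieldIso.inv := by
      ext b; rfl
    rw [← heN]
    exact ProjectiveSpace.specMap_comp_pointOfVec_left eN.toAlgHom w hw
  have hdefN : ∀ x : N.X, IsDefinedAt zN x := isDefinedAt_of_comp_eq_pointOfVec zN ιN hzN0 hrN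
  /- the ideal sheaf `I = 𝒪_M(-E)·(z₀, …, zₙ)` on `M` -/
  obtain ⟨I, hI0, hI⟩ := exists_idealSheaf_of_hom (X := M.X) rM z hz0
  /- Step 1: `I·𝒪_N` is an effective Cartier divisor -/
  have hcart : IsEffectiveCartier (I.comap φ.f) := by
    rw [isEffectiveCartier_iff_forall_mem_cartierLocus]
    intro x
    obtain ⟨q, hq0, g, hg, hIx⟩ := hI (φ.f x)
    obtain ⟨i, hxi⟩ := hdefN x
    let g' : Fin (n + 1) → N.X.presheaf.stalk x := fun l => (φ.f.stalkMap x).hom (g l)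
    have e1 : stalkIdeal (I.comap φ.f) x = Ideal.span (Set.range g') := by
      rw [stalkIdeal_comap_eq_map_stalkMap, hIx, Ideal.map_span, ← Set.range_comp]
      rfl
    have hg' : ∀ l, toFunctionField x (g' l) = functionFieldMap φ.f q * zN l := by
      intro l
      change toFunctionField x ((φ.f.stalkMap x) (g l)) = _
      rw [← functionFieldMap_toFunctionField, hg l, map_mul, hφz]
    have hgi : g' i ≠ 0 := by
      intro h0
      have := hg' i
      rw [h0, map_zero] at this
      exact mul_ne_zero ((map_ne_zero _).mpr hq0) (ne_zero_of_mem_lsChart zN hxi) this.symm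
    refine ⟨g' i, mem_nonZeroDivisors_of_ne_zero hgi, ?_⟩
    rw [e1]
    exact span_range_eq_span_singleton_of_mem_lsChart hxi g' hg'
  /- the blowing up `π : B → M` of `I`; `B` is a proper model of `K/k` -/
  obtain ⟨B, π, hπ⟩ := exists_isBlowup M.X I
  haveI : IsIntegral B := hπ.isIntegral hI0
  haveI : IsProper π := hπ.isProper
  have hU : ((centreCompl I : M.X.Opens) : Set M.X).Nonempty := centreCompl_nonempty hI0
  haveI : IsIso (π ∣_ centreCompl I) := hπ.isIso_compl
  let Bm : ProperModel k K := ProperModel.ofModification M π (centreCompl I) hU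
  let πm : Bm.Hom M := ProperModel.ofModificationHom M π (centreCompl I) hU
  haveI : IsDominant π := ProperModel.Hom.isDominant πm
  /- `g : N → B` from the universal property, a morphism of models -/
  let g : N.X ⟶ B := hπ.lift φ.f hcart
  have hgπ : g ≫ π = φ.f := hπ.lift_comp φ.f hcart
  have hgen_g : N.gen ≫ g = Bm.gen := by
    apply hom_ext_of_isIso_morphismRestrict π (centreCompl I)
    · rw [Category.assoc, hgπ, φ.gen_f]
      exact (ProperModel.genOfModification_ρ M π (centreCompl I) hU).symm
    · rw [Category.assoc, hgπ, φ.gen_f, ProperModel.range_gen]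
      exact Set.singleton_subset_iff.mpr (genericPoint_mem_centreCompl hI0)
  let gm : N.Hom Bm :=
    { f := g
      f_π := by
        change g ≫ π ≫ M.π = N.π
        rw [← Category.assoc, hgπ, φ.f_π]
      gen_f := hgen_g }
  /- Step 2: the rational map `B ⋯→ N` is defined everywhere -/
  let zB : Fin (n + 1) → B.functionField := fun l => Bm.funFieldAlgEquiv.symm (w l)
  have hπz : ∀ l, functionFieldMap π (z l) = zB l := fun l =>
    functionFieldMap_funFieldAlgEquiv_symm πm (w l)
  have hdefB : ∀ b : B, IsDefinedAt zB b := by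
    intro b
    obtain ⟨u, hu, hux⟩ := hπ.isEffectiveCartier.exists_stalkIdeal_eq_span b
    obtain ⟨q, -, g₀, hg₀, hIx⟩ := hI (π b)
    rw [stalkIdeal_comap_eq_map_stalkMap, hIx, Ideal.map_span, ← Set.range_comp] at hux
    refine isDefinedAt_of_span_range_eq_span_singleton (q := functionFieldMap π q)
      (fun l => (π.stalkMap b).hom (g₀ l)) (fun l => ?_) (nonZeroDivisors.ne_zero hu) hux
    change toFunctionField b ((π.stalkMap b) (g₀ l)) = _
    rw [← functionFieldMap_toFunctionField, hg₀ l, map_mul, hπz]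
  /- the morphism `h : B → N` of models -/
  obtain ⟨h₀, hhπ, hhgen⟩ := Bm.exists_hom_of_forall_isDefinedAt N ιN hιN w hw hgenN hdefB
  let hm : Bm.Hom N := { f := h₀, f_π := hhπ, gen_f := hhgen }
  let h : B ⟶ N.X := h₀
  /- Step 3: `g` and `h` are inverse to each other -/
  have h1 : h ≫ φ.f = π := ProperModel.Hom.f_eq (hm.comp φ) πm
  have h2 : g ≫ h = 𝟙 N.X := ProperModel.Hom.f_eq (gm.comp hm) (ProperModel.Hom.id N)
  have h3 : h ≫ g = 𝟙 B := hπ.eq_id_of_comp_eq (by rw [Category.assoc, hgπ, h1])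
  let eg : N.X ≅ B := ⟨g, h, h2, h3⟩
  refine ⟨I, hI0, ?_⟩
  have key := hπ.iso_comp eg
  rwa [show eg.hom ≫ π = φ.f from hgπ] at key

end ProperModel

/-! ## The named fact -/

/-- **DISCHARGE of `Liu2002Thm8124Projective`** (Liu 2002, Thm. 8.1.24, for a birational
`k`-morphism `f : X → Y` of integral projective `k`-schemes): `f` is a blowing up of `Y` along a
non-zero ideal sheaf. With `K = K(Y)`: `Y` is a proper model of `K/k` (generic point
`Spec K(Y) → Y`), `X` is one via the isomorphism `f⁻¹(U) ≅ U` (`ProperModel.ofModification`), `f`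
is a morphism of models, and `ProperModel.Hom.exists_isBlowup_of_isProjectiveOver` applies.
[cite: Liu2002, Thm. 8.1.24] -/
theorem Liu2002Thm8124Projective_holds : Liu2002Thm8124Projective.{u} := by
  intro k _ X Y f πX πY hX hY hpX hpY hf hbir
  haveI := hX
  haveI := hY
  letI : Y.Over (Spec (.of k)) := ⟨πY⟩
  letI : Algebra k Y.functionField := RatFn.algebraStalk k (genericPoint Y)
  haveI : IsProper πY := hpY.isProper
  /- `Y` as a proper model of `K(Y)/k` -/
  have hgenY : Y.fromSpecStalk (genericPoint Y) ≫ πY =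
      Spec.map (CommRingCat.ofHom (algebraMap k Y.functionField)) := by
    have h1 : πY = Y.toSpecΓ ≫ Spec.map ((Scheme.ΓSpecIso (.of k)).inv ≫ πY.appTop) := by
      rw [Spec.map_comp, ← Scheme.toSpecΓ_naturality_assoc, toSpecΓ_SpecMap_ΓSpecIso_inv,
        Category.comp_id]
    rw [h1, Scheme.fromSpecStalk_toSpecΓ_assoc, ← Spec.map_comp]
    rfl
  let M : ProperModel k Y.functionField :=
    { X := Y
      π := πY
      gen := Y.fromSpecStalk (genericPoint Y)
      gen_π := hgenY
      isIntegral := hY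
      isProper := inferInstance
      genericPt_eq := Scheme.fromSpecStalk_closedPoint
      isIso_stalkClosedPointTo := by
        rw [Scheme.stalkClosedPointTo_fromSpecStalk]
        infer_instance }
  /- `X` as a proper model dominating `M` -/
  obtain ⟨U, hUd, -, hiso⟩ := hbir
  have hUne : (U : Set Y).Nonempty := hUd.nonempty
  haveI := hiso
  haveI : IsProper (f ≫ πY) := by rw [hf]; exact hpX.isProper
  haveI : IsProper f := IsProper.of_comp f πY
  let N : ProperModel k Y.functionField := ProperModel.ofModification M f U hUne
  let φ : N.Hom M := ProperModel.ofModificationHom M f U hUne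
  have hN : IsProjectiveOver (Over.mk N.π) := by
    change IsProjectiveOver (Over.mk (f ≫ πY))
    rw [hf]
    exact hpX
  obtain ⟨I, hI0, hI⟩ := φ.exists_isBlowup_of_isProjectiveOver hN hpY
  exact ⟨I, hI0, hI⟩

end Literature.AlgebraicGeometry.Resolution

end
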